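import Summits.BirchSwinnertonDyer.BirchSwinnertonDyer.Theorems.TwoAdicConverseLambdaHalfDefs
import HarnessLib

/-!
# Crux `OrdLambdaHalfAtTwo` (item stmt-BirchSwinnertonDyer-19556) — crux-ideate 2/g6 sketch for the idea
# `kato-determinant-greenberg-two` (stratum (β): `E(ℚ)[2] ≠ 0`)

NOTHING is asserted here: three kernel-checked pieces of ARITHMETIC and one typed DOOR into the per-curve leaf
`LambdaHalfAtTwo W` of the crux, displaying the shape of the line

  Kato ⊗ ℚ at `2` for `E` and `E^K` (tree fact `kato_divisibility_allPrimes`, gives `b ≤ a`, `b' ≤ a'`)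
  + the Poitou–Tate identity on the cyclotomic line over an auxiliary imaginary quadratic `K` (2 split), comparing the
    ORDINARY Selmer structure with the GREENBERG structure (relaxed at `v`, strict at `v̄`) for the SAME global
    Iwasawa cohomology and Kato's two classes `z_E`, `z_{E^K}` (`hPT`; `gD` = λ of the «Kato determinant»
    `loc_{v̄} z_E ∧ loc_{v̄} z_{E^K}`; `e`, `e'` = explicit local torsion / regulator corrections)
  + ONE inequality on the Greenberg side (`hGr`, Eisenstein direction: the Kato determinant is at most `char X_Gr`)
  ⟹ `λ_an = λ_alg` for BOTH `E` and `E^K`, in particular the leaf for `E`.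

BSD is not proved; the crux stays open; the (β)-stratum inputs behind `hPT`/`hGr` are research (see the idea card).
-/

set_option linter.dupNamespace false
set_option autoImplicit false

noncomputable section

open scoped MatrixGroups ModularForm
open CongruenceSubgroup WeierstrassCurve Literature.NumberTheory.EllipticCurves
  Literature.NumberTheory.EllipticCurves.ModularForms Literature.NumberTheory.EllipticCurves.Rank1Residual
  Summit.BirchSwinnertonDyer.Rank1Residual.X1.MuLambda
  Summit.BirchSwinnertonDyer.BirchSwinnertonDyer.Theorems.TwoAdicTwistConverse

namespace Summit.BirchSwinnertonDyer.BirchSwinnertonDyer.Cruxes.OrdLambdaHalfAtTwo.KatoDeterminantGreenbergTwo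

/-! ## §1 Sum-splitting: Kato termwise + the reversed inequality for the SUM ⟹ termwise equality -/

/-- `a, a'` = analytic `λ` of `E`, `E^K`; `b, b'` = algebraic. Kato: `b ≤ a`, `b' ≤ a'`. If the SUM satisfies the
crux direction `a + a' ≤ b + b'` then both curves satisfy `λ_an = λ_alg`. [folklore] -/
theorem pair_eq_of_kato_of_sum_le {a a' b b' : ℕ} (hK : b ≤ a) (hK' : b' ≤ a') (hsum : a + a' ≤ b + b') :
    a = b ∧ a' = b' := by
  omega

/-! ## §2 The Greenberg-detour arithmetic on the cyclotomic line over `K`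

`gAlg = λ(X_Gr(E/K·ℚ_∞))`, `gD = λ(loc_{v̄} z_E ∧ loc_{v̄} z_{E^K})` (Kato determinant), `e, e'` explicit corrections.
`hPT` is the Poitou–Tate identity written additively in `ℕ`:
`λ(X_Gr) − λ(D) − e' = λ(X_ord(E/Kℚ_∞)) − λ(L₂(E)·L₂(E^K)) − e` with `λ(X_ord(E/Kℚ_∞)) = b + b'` (Shapiro ⊗ ℚ)
and `λ(L₂(E)L₂(E^K)) = a + a'` (`lam_mul`). -/

/-- Kato's two divisibilities ALONE already give the Greenberg-side inequality in Kato's direction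
(`char X_Gr ∣ D` up to the corrections) — the `p = 2` shadow of BSTW Prop. 1.19 («a one-sided divisibility in any of
the three main conjectures implies the analogous divisibility in the others»). [cite: arXiv:2409.01350, Prop. 1.19] -/
theorem greenberg_le_of_kato {a a' b b' gAlg gD e e' : ℕ} (hK : b ≤ a) (hK' : b' ≤ a')
    (hPT : gAlg + (a + a') + e = gD + (b + b') + e') : gAlg + e ≤ gD + e' := by
  omega

/-- **The spine.** Kato termwise (`hK`, `hK'`) + Poitou–Tate two ways (`hPT`) + the EISENSTEIN-direction inequality on
the Greenberg side (`hGr` : `D`, corrected, is at most `char X_Gr`) ⟹ `λ_an = λ_alg` for `E` AND for `E^K`. [folklore] -/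
theorem pair_eq_of_greenbergDetour {a a' b b' gAlg gD e e' : ℕ} (hK : b ≤ a) (hK' : b' ≤ a')
    (hPT : gAlg + (a + a') + e = gD + (b + b') + e') (hGr : gD + e' ≤ gAlg + e) : a = b ∧ a' = b' := by
  omega

/-! ## §3 Typed door into the crux leaf `LambdaHalfAtTwo W` -/

/-- **Door.** For a curve `W` (think: stratum (β), `W(ℚ)[2] ≠ 0`, non-CM, good ordinary at `2`) whose cyclotomic data
carry an analytic `λ`-certificate `a` (some nonzero integral rational multiple `L₀` of `L₂(f,α)` with `λ(L₀) = a`) and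
algebraic `λ = b`, the four numeric hypotheses of §2 (Kato for `W` and its `K`-twist, Poitou–Tate over `K·ℚ_∞`, the
Greenberg-side inequality) give the leaf `LambdaHalfAtTwo W` with EQUALITY. Pure bookkeeping; nothing asserted. -/
theorem lambdaHalfAtTwo_of_greenbergDetour (W : WeierstrassCurve ℚ) [W.IsElliptic] [W.IsGloballyMinimal]
    {a a' b b' gAlg gD e e' : ℕ}
    (hcert : ∀ (κ : ZpExtension ℚ 2) (γ : Field.absoluteGaloisGroup ℚ), κ.IsCyclotomic → κ.IsTopGenerator γ →
      IsCyclotomicVariable 2 γ → IsOrdinaryAt W 2 →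
      ∀ [NeZero (W.conductorNorm ℤ)] (f : CuspForm (Gamma0 (W.conductorNorm ℤ)) 2), IsNewformOf W f →
      ∀ (D : W.SelmerDualData κ γ), ∃ (c : ℚ) (L₀ : IwasawaAlgebra 2), L₀ ≠ 0 ∧
        iwasawaToPowerSeries 2 L₀ = PowerSeries.C (c : ℚ_[2]) * padicLFunction f (unitRoot W 2 : ℚ_[2]) ∧
        lam L₀ = a ∧ D.lambda = b)
    (hK : b ≤ a) (hK' : b' ≤ a')
    (hPT : gAlg + (a + a') + e = gD + (b + b') + e') (hGr : gD + e' ≤ gAlg + e) :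
    LambdaHalfAtTwo W := by
  intro κ γ hκ hγ hγ' hord _ f hf D
  obtain ⟨c, L₀, h0, hι, ha, hb⟩ := hcert κ γ hκ hγ hγ' hord f hf D
  refine ⟨c, L₀, h0, hι, ?_⟩
  have h := (pair_eq_of_greenbergDetour hK hK' hPT hGr).1
  omega

/-! ## §4 The honest scope of the line: the (β)-stratum of the crux, as a `Prop` (displayed, not asserted) -/

/-- **Stratum (β) of `OrdLambdaHalfAtTwo`**: the crux restricted to curves with a RATIONAL point of order `2`
(`E[2]` reducible; at `p = 2` both Jordan–Hölder characters of `E[2]` are trivial — the maximally Eisenstein case, where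
the Greenberg-normalised objects over `K` reduce mod `2` to `GL(1)/K`). The complement (E[2] irreducible) is the habitat
of the registered skeleton `Lines/birth.lean` and of the pen's lines L1–L3; this idea says nothing there. -/
def OrdLambdaHalfAtTwoBeta : Prop :=
  ∀ (W : WeierstrassCurve ℚ) [W.IsElliptic] [W.IsGloballyMinimal], ¬ W.HasCM → GoodOrd W 2 →
    (∃ x y : ℚ, W.toAffine.Equation x y ∧ 2 * y + W.a₁ * x + W.a₃ = 0) → LambdaHalfAtTwo W

end Summit.BirchSwinnertonDyer.BirchSwinnertonDyer.Cruxes.OrdLambdaHalfAtTwo.KatoDeterminantGreenbergTwo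

end
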